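import Summits.QuantumFields.BalabanUV.T4Continuum.Spine.NE7.Targets

/-!
# `window-key-core` — EDITION 2 kernel (idea-3 g9, crux K3⁷ `SpineGivenEndpointR13SepCoPH` = stmt-QuantumFields-20544)
# THE THREE FACES OF STUB 2 FORCE THE TWO RUNS' CLASS LAWS TO MERGE; NO `Bad` ∕ SHELL ∕ CUT DIAL RESCUES A LAW-SEPARATED PAIR

Answer to CRIT-1 triage `CRIT-1-TRIAGE-window-key-core.md` check (3)(iii) («SHELL DIAL — `sh : ShellSplit₁₃CoPH 2 0` is a genuine
letter; the caricature has `Bad := ∅`, `A ≡ 1`, no shells; before “no supplier can serve stub 2 at its pin” stands, cdisprove must show the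
extensive old-large-field contrast cannot be moved into shells that still pay `KeyedShellWeight`»).

SETTING = the SHAPES stub 2 of the v5 skeleton (`K3Skeleton13SepCoPHv5`, sha16 941dddb108cbaacf) conjoins AT THE PINNED CARRIERS: by
`PinnedAtLive` + the dictionary `crOfRecord₁₃VAt_T ∕ _A ∕ _B` the index family `T` (= `classSet₁₃ θ 0 g₀`) and the two runs' class weights
`A` (= `weightA₁₃ …`), `B` (= `weightB₁₃ …`) do NOT depend on the dials `jc : CutReading`, `sh : ShellSplit₁₃CoPH 2 0`; only
`Bad` (= `badClass₁₃ … (jc …)`), the shells `shA ∕ shB` (= `sh`'s components), the weights `W`, `Wsh` and the existential `δ`, `c` move.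
The three faces are `KeyedRelWeight` = `T4WeightBudget.RelWeightBound l₀ T A B Bad W`, `KeyedShellWeight` =
`T4IndicatorShell.ShellWeightBound l₀ T A B shA shB Wsh`, `KeyedCoreEdgeHolderD4`'s body = `∃ δ, Spine.NE7.Core l₀ vol T Bad (A − shA) (B − shB) δ ∧ Summable δ`.

WHAT IS PROVED ([folklore] real arithmetic on hypothesis SHAPES; 0 `sorry`).
* §1 `setSum_sandwich` — the three faces ⇒ for every `K` ONE constant `c` with, for every `|t| ≤ l₀` and EVERY set of classes `S ⊆ T K`,
  `Σ_S B ≤ e^{c+vol·δ_K}·Σ_S A + (W_K + Wsh_K)·Σ_T B` and `Σ_S A ≤ e^{−c+vol·δ_K}·Σ_S B + (W_K + Wsh_K)·Σ_T A` — whatever `Bad`, whatever shells.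
* §2 `classLaw_le_of_faces` ∕ `abs_classLaw_sub_le_of_faces` — hence the normalised CLASS LAWS `μ_X^{K,t}(S) = Σ_S X ∕ Σ_T X` of the two runs
  satisfy `μ_B(S) ≤ M_K·μ_A(S) + ε_K`, `μ_A(S) ≤ M_K·μ_B(S) + ε_K` and `|μ_B(S) − μ_A(S)| ≤ (M_K − 1) + ε_K =: ρ_K`, with `ε_K = W_K + Wsh_K`,
  `M_K = e^{2|vol·δ_K|} ∕ (1 − ε_K)`; `tendsto_rho`: `ρ_K → 0` (δ, W, Wsh summable).
* §3 ★ `no_dial_rescues` — LAW SEPARATION `LawSeparated l₀ T A B s` (`s > 0`: for every `K₀` some `K ≥ K₀`, `|t| ≤ l₀`, `S ⊆ T K` with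
  `μ_B(S) − μ_A(S) ≥ s`) and positive run-A totals ⇒ `¬ ∃ Bad W shA shB Wsh δ, RelWeightBound ∧ ShellWeightBound ∧ (Core ∧ Summable δ)`;
  `not_hybridNE7_of_lawSeparated` — the same for `T4MatchingAssembly.HybridNE7`.  The `Bad` dial can only absorb a class set of relative mass
  `≤ W_K → 0`, the shell dial only `≤ Wsh_K → 0` of the total: an `O(1)` law discrepancy has nowhere to go.
* §4 `toy_lawSeparated` ∕ `toy_no_dial` ∕ `toy_target` — NON-VACUITY and TARGET-COMPATIBILITY: two classes, `A_K = 4^K·(1,1)`, `B_K = 4^K·(6,2)`: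
  laws separated (`s = 1∕4`), so NO dial gives the three faces, while node U5's DECL target `Spine.NE7.Target vol l₀ 0 Z` holds EXACTLY
  (`Z_{K+1}∕Z_K = 4`, `δ ≡ 0`) — consistent with dag-n19-w1 `…N19HybridBeyondTarget` (the hybrid road asks MORE than the target) and extending its
  fixed-`Bad` handle `not_coreEdge_of_unsummable_gap` to ALL dials at once.

WHAT IS NOT PROVED.  Whether the class laws of the record (`classSet₁₃`, `weightA₁₃`, `weightB₁₃` at `K₀ = 0`, tuned `g₀`) SEPARATE is NOT decided
here — that is the card's conditional (SAT′) ∧ (XG′) in law form and the cheapest falsifier handed to cdisprove.  HONEST FRAMING: hypothesis shapes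
only; nothing of Bałaban's instantiated; NE7 not printed for d = 4, not proved; K3⁷ NOT claimed; the YM mass gap (Clay) is NOT proved by any of this;
R4 closes the conditional finite-𝕋⁴ rung `BalabanLadder.UV` only; [Balaban1988Convergent] Thm 2 unproved in print.  0 `sorry`, standard axioms.
-/

open Finset Filter Topology
open Literature.MathematicalPhysics.QuantumFieldTheory.Balaban1983to89
open Literature.MathematicalPhysics.QuantumFieldTheory.Balaban1983to89.T4CauchySum
open Literature.MathematicalPhysics.QuantumFieldTheory.Balaban1983to89.T4WeightBudget
open Literature.MathematicalPhysics.QuantumFieldTheory.Balaban1983to89.T4IndicatorShell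
open Literature.MathematicalPhysics.QuantumFieldTheory.Balaban1983to89.T4MatchingAssembly
open Summit.QuantumFields.BalabanUV.T4Continuum.Spine.NE7

namespace YMNodeOIdeate.Idea3.WindowKeyCore.LawMerge

variable {ι : Type*} [DecidableEq ι] {l₀ vol : ℝ} {T : ℕ → Finset ι} {A B shA shB : ℕ → ℝ → ι → ℝ}
  {Bad : ℕ → ℝ → Finset ι} {W Wsh δ : ℕ → ℝ}

/-! ## §1 The set-sum sandwich: every class set, whatever the bad class and the shells -/

/-- **THE SET-SUM SANDWICH.**  NE7b ∧ NE7c ∧ NE7-proper on the cores ⇒ for every `K` ONE constant `c` (the core's) such that for every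
`|t| ≤ l₀` and every `S ⊆ T K`: `Σ_S B ≤ e^{c+vol·δ_K}·Σ_S A + (W_K+Wsh_K)·Σ_T B` and `Σ_S A ≤ e^{−c+vol·δ_K}·Σ_S B + (W_K+Wsh_K)·Σ_T A`.
Proof: split `S` into `S ∩ Bad` (relative weight `≤ W_K`, `bad_left ∕ bad_right`) and `S ∖ Bad` (write `B = (B − shB) + shB`, core sandwich,
`0 ≤ sh`, total shell `≤ Wsh_K`, `left ∕ right`). [folklore] -/
theorem setSum_sandwich (hW : RelWeightBound l₀ T A B Bad W) (hSh : ShellWeightBound l₀ T A B shA shB Wsh)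
    (hcore : Core l₀ vol T Bad (fun K t τ => A K t τ - shA K t τ) (fun K t τ => B K t τ - shB K t τ) δ) (K : ℕ) :
    ∃ c : ℝ, ∀ t : ℝ, |t| ≤ l₀ → ∀ S, S ⊆ T K →
      ∑ τ ∈ S, B K t τ ≤ Real.exp (c + vol * δ K) * ∑ τ ∈ S, A K t τ + (W K + Wsh K) * ∑ τ ∈ T K, B K t τ ∧
      ∑ τ ∈ S, A K t τ ≤ Real.exp (-c + vol * δ K) * ∑ τ ∈ S, B K t τ + (W K + Wsh K) * ∑ τ ∈ T K, A K t τ := by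
  obtain ⟨c, hc⟩ := hcore K
  refine ⟨c, fun t ht S hS => ?_⟩
  have hA0 : ∀ τ ∈ T K, 0 ≤ A K t τ := fun τ hτ =>
    (hSh.sh_nonneg_left K t ht τ hτ).trans (hSh.sh_le_left K t ht τ hτ)
  have hB0 : ∀ τ ∈ T K, 0 ≤ B K t τ := fun τ hτ =>
    (hSh.sh_nonneg_right K t ht τ hτ).trans (hSh.sh_le_right K t ht τ hτ)
  have hBadT : Bad K t ⊆ T K := hW.bad_subset K t ht
  have hsplitB := Finset.sum_inter_add_sum_sdiff S (Bad K t) (fun τ => B K t τ)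
  have hsplitA := Finset.sum_inter_add_sum_sdiff S (Bad K t) (fun τ => A K t τ)
  -- the bad parts
  have hbadB : ∑ τ ∈ S ∩ Bad K t, B K t τ ≤ W K * ∑ τ ∈ T K, B K t τ :=
    (Finset.sum_le_sum_of_subset_of_nonneg Finset.inter_subset_right
      (fun τ hτ _ => hB0 τ (hBadT hτ))).trans (hW.bad_right K t ht)
  have hbadA : ∑ τ ∈ S ∩ Bad K t, A K t τ ≤ W K * ∑ τ ∈ T K, A K t τ :=
    (Finset.sum_le_sum_of_subset_of_nonneg Finset.inter_subset_right
      (fun τ hτ _ => hA0 τ (hBadT hτ))).trans (hW.bad_left K t ht)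
  -- the shells on the good part
  have hsub : S \ Bad K t ⊆ T K := Finset.sdiff_subset.trans hS
  have hshB : ∑ τ ∈ S \ Bad K t, shB K t τ ≤ Wsh K * ∑ τ ∈ T K, B K t τ :=
    (Finset.sum_le_sum_of_subset_of_nonneg hsub
      (fun τ hτ _ => hSh.sh_nonneg_right K t ht τ hτ)).trans (hSh.right K t ht)
  have hshA : ∑ τ ∈ S \ Bad K t, shA K t τ ≤ Wsh K * ∑ τ ∈ T K, A K t τ :=
    (Finset.sum_le_sum_of_subset_of_nonneg hsub
      (fun τ hτ _ => hSh.sh_nonneg_left K t ht τ hτ)).trans (hSh.left K t ht)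
  -- the good cores, termwise
  have hE : Real.exp (-c + vol * δ K) * Real.exp (c - vol * δ K) = 1 := by
    rw [← Real.exp_add]; convert Real.exp_zero using 2; ring
  have hgoodB : ∑ τ ∈ S \ Bad K t, B K t τ ≤
      Real.exp (c + vol * δ K) * ∑ τ ∈ S \ Bad K t, A K t τ + ∑ τ ∈ S \ Bad K t, shB K t τ := by
    rw [Finset.mul_sum, ← Finset.sum_add_distrib]
    refine Finset.sum_le_sum fun τ hτ => ?_
    have hτT : τ ∈ T K := hsub hτ
    have hτgood : τ ∈ T K \ Bad K t := Finset.mem_sdiff.2 ⟨hτT, (Finset.mem_sdiff.1 hτ).2⟩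
    have h2 := (hc t ht τ hτgood).2
    have := mul_nonneg (Real.exp_pos (c + vol * δ K)).le (hSh.sh_nonneg_left K t ht τ hτT)
    linarith
  have hgoodA : ∑ τ ∈ S \ Bad K t, A K t τ ≤
      Real.exp (-c + vol * δ K) * ∑ τ ∈ S \ Bad K t, B K t τ + ∑ τ ∈ S \ Bad K t, shA K t τ := by
    rw [Finset.mul_sum, ← Finset.sum_add_distrib]
    refine Finset.sum_le_sum fun τ hτ => ?_
    have hτT : τ ∈ T K := hsub hτ
    have hτgood : τ ∈ T K \ Bad K t := Finset.mem_sdiff.2 ⟨hτT, (Finset.mem_sdiff.1 hτ).2⟩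
    have h1 := (hc t ht τ hτgood).1
    have h1' : A K t τ - shA K t τ ≤ Real.exp (-c + vol * δ K) * (B K t τ - shB K t τ) := by
      have := mul_le_mul_of_nonneg_left h1 (Real.exp_pos (-c + vol * δ K)).le
      rwa [← mul_assoc, hE, one_mul] at this
    have := mul_nonneg (Real.exp_pos (-c + vol * δ K)).le (hSh.sh_nonneg_right K t ht τ hτT)
    linarith
  -- monotonicity of the good sums in `S ∖ Bad ⊆ S`
  have hmonoA : Real.exp (c + vol * δ K) * ∑ τ ∈ S \ Bad K t, A K t τ ≤ Real.exp (c + vol * δ K) * ∑ τ ∈ S, A K t τ :=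
    mul_le_mul_of_nonneg_left (Finset.sum_le_sum_of_subset_of_nonneg Finset.sdiff_subset
      (fun τ hτ _ => hA0 τ (hS hτ))) (Real.exp_pos _).le
  have hmonoB : Real.exp (-c + vol * δ K) * ∑ τ ∈ S \ Bad K t, B K t τ ≤ Real.exp (-c + vol * δ K) * ∑ τ ∈ S, B K t τ :=
    mul_le_mul_of_nonneg_left (Finset.sum_le_sum_of_subset_of_nonneg Finset.sdiff_subset
      (fun τ hτ _ => hB0 τ (hS hτ))) (Real.exp_pos _).le
  have hdB : (W K + Wsh K) * ∑ τ ∈ T K, B K t τ = W K * ∑ τ ∈ T K, B K t τ + Wsh K * ∑ τ ∈ T K, B K t τ := add_mul _ _ _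
  have hdA : (W K + Wsh K) * ∑ τ ∈ T K, A K t τ = W K * ∑ τ ∈ T K, A K t τ + Wsh K * ∑ τ ∈ T K, A K t τ := add_mul _ _ _
  constructor <;> linarith

/-! ## §2 The class laws merge -/

/-- The normalised CLASS LAW of a run at `(K, t)`: `S ↦ Σ_S X ∕ Σ_{T K} X` (the law of "which class" under the run's dressed weights). -/
noncomputable def classLaw (T : ℕ → Finset ι) (X : ℕ → ℝ → ι → ℝ) (K : ℕ) (t : ℝ) (S : Finset ι) : ℝ :=
  (∑ τ ∈ S, X K t τ) / ∑ τ ∈ T K, X K t τ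

/-- The merge slope `M_K = e^{2|vol·δ_K|} ∕ (1 − (W_K + Wsh_K))`. -/
noncomputable def slope (vol : ℝ) (δ W Wsh : ℕ → ℝ) (K : ℕ) : ℝ :=
  Real.exp (2 * |vol * δ K|) / (1 - (W K + Wsh K))

/-- The merge radius `ρ_K = (M_K − 1) + (W_K + Wsh_K)`. -/
noncomputable def rho (vol : ℝ) (δ W Wsh : ℕ → ℝ) (K : ℕ) : ℝ :=
  (slope vol δ W Wsh K - 1) + (W K + Wsh K)

/-- `e^{x + y} ≤ e^{x}·e^{|y|}` and `e^{−x + y} ≤ e^{−x}·e^{|y|}` bookkeeping: `e^{a + y} ≤ e^{a + |y|}`. -/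
theorem exp_add_le_exp_add_abs (a y : ℝ) : Real.exp (a + y) ≤ Real.exp (a + |y|) :=
  Real.exp_le_exp.2 (by linarith [le_abs_self y])

/-- **AFFINE DOMINATION OF THE CLASS LAWS.**  Under the three faces, at every `(K, t)` with `W_K + Wsh_K < 1` and a positive run-A total, for every
`S ⊆ T K`: `μ_B(S) ≤ M_K·μ_A(S) + ε_K` and `μ_A(S) ≤ M_K·μ_B(S) + ε_K` (`ε_K = W_K + Wsh_K`), and the run-B total is positive too. [folklore] -/
theorem classLaw_le_of_faces (hW : RelWeightBound l₀ T A B Bad W) (hSh : ShellWeightBound l₀ T A B shA shB Wsh)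
    (hcore : Core l₀ vol T Bad (fun K t τ => A K t τ - shA K t τ) (fun K t τ => B K t τ - shB K t τ) δ)
    {K : ℕ} (hε : W K + Wsh K < 1) {t : ℝ} (ht : |t| ≤ l₀) (hZA : 0 < ∑ τ ∈ T K, A K t τ) {S : Finset ι} (hS : S ⊆ T K) :
    0 < ∑ τ ∈ T K, B K t τ ∧
    classLaw T B K t S ≤ slope vol δ W Wsh K * classLaw T A K t S + (W K + Wsh K) ∧
    classLaw T A K t S ≤ slope vol δ W Wsh K * classLaw T B K t S + (W K + Wsh K) := by
  obtain ⟨c, hc⟩ := setSum_sandwich hW hSh hcore K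
  have hA0 : ∀ τ ∈ T K, 0 ≤ A K t τ := fun τ hτ =>
    (hSh.sh_nonneg_left K t ht τ hτ).trans (hSh.sh_le_left K t ht τ hτ)
  have hB0 : ∀ τ ∈ T K, 0 ≤ B K t τ := fun τ hτ =>
    (hSh.sh_nonneg_right K t ht τ hτ).trans (hSh.sh_le_right K t ht τ hτ)
  set η := vol * δ K with hη
  set ε := W K + Wsh K with hεdef
  set ZA := ∑ τ ∈ T K, A K t τ with hZAdef
  set ZB := ∑ τ ∈ T K, B K t τ with hZBdef
  set sA := ∑ τ ∈ S, A K t τ with hsAdef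
  set sB := ∑ τ ∈ S, B K t τ with hsBdef
  have h1ε : 0 < 1 - ε := by linarith
  obtain ⟨hST_B, hST_A⟩ := hc t ht (T K) subset_rfl
  obtain ⟨hS_B, hS_A⟩ := hc t ht S hS
  have hsA0 : 0 ≤ sA := Finset.sum_nonneg fun τ hτ => hA0 τ (hS hτ)
  have hsB0 : 0 ≤ sB := Finset.sum_nonneg fun τ hτ => hB0 τ (hS hτ)
  -- totals: `(1 − ε)·ZA ≤ e^{−c+η}·ZB`, `(1 − ε)·ZB ≤ e^{c+η}·ZA`; positivity of `ZB`
  have hTA : (1 - ε) * ZA ≤ Real.exp (-c + η) * ZB := by nlinarith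
  have hTB : (1 - ε) * ZB ≤ Real.exp (c + η) * ZA := by nlinarith
  have hZB : 0 < ZB := by
    have h : Real.exp (-c + η) * 0 < Real.exp (-c + η) * ZB := by
      rw [mul_zero]; exact lt_of_lt_of_le (mul_pos h1ε hZA) hTA
    exact lt_of_mul_lt_mul_left h (Real.exp_pos _).le
  refine ⟨hZB, ?_, ?_⟩
  · -- `e^{c+η} ≤ e^{2|η|}·ZB ∕ ((1−ε)·ZA)`
    have key : Real.exp (c + η) * ((1 - ε) * ZA) ≤ Real.exp (2 * |η|) * ZB := by
      calc Real.exp (c + η) * ((1 - ε) * ZA)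
          ≤ Real.exp (c + η) * (Real.exp (-c + η) * ZB) := mul_le_mul_of_nonneg_left hTA (Real.exp_pos _).le
        _ = Real.exp (2 * η) * ZB := by rw [← mul_assoc, ← Real.exp_add]; ring_nf
        _ ≤ Real.exp (2 * |η|) * ZB :=
          mul_le_mul_of_nonneg_right (Real.exp_le_exp.2 (by linarith [le_abs_self η])) hZB.le
    have key' : Real.exp (c + η) ≤ Real.exp (2 * |η|) * ZB / ((1 - ε) * ZA) :=
      (le_div_iff₀ (mul_pos h1ε hZA)).2 key
    have h3 : sB ≤ Real.exp (2 * |η|) * ZB / ((1 - ε) * ZA) * sA + ε * ZB :=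
      hS_B.trans (by nlinarith [mul_le_mul_of_nonneg_right key' hsA0])
    unfold classLaw slope
    rw [← hsAdef, ← hsBdef, ← hZAdef, ← hZBdef, div_le_iff₀ hZB]
    calc sB ≤ Real.exp (2 * |η|) * ZB / ((1 - ε) * ZA) * sA + ε * ZB := h3
      _ = (Real.exp (2 * |η|) / (1 - ε) * (sA / ZA) + ε) * ZB := by
        field_simp
  · have key : Real.exp (-c + η) * ((1 - ε) * ZB) ≤ Real.exp (2 * |η|) * ZA := by
      calc Real.exp (-c + η) * ((1 - ε) * ZB)
          ≤ Real.exp (-c + η) * (Real.exp (c + η) * ZA) := mul_le_mul_of_nonneg_left hTB (Real.exp_pos _).le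
        _ = Real.exp (2 * η) * ZA := by rw [← mul_assoc, ← Real.exp_add]; ring_nf
        _ ≤ Real.exp (2 * |η|) * ZA :=
          mul_le_mul_of_nonneg_right (Real.exp_le_exp.2 (by linarith [le_abs_self η])) hZA.le
    have key' : Real.exp (-c + η) ≤ Real.exp (2 * |η|) * ZA / ((1 - ε) * ZB) :=
      (le_div_iff₀ (mul_pos h1ε hZB)).2 key
    have h3 : sA ≤ Real.exp (2 * |η|) * ZA / ((1 - ε) * ZB) * sB + ε * ZA :=
      hS_A.trans (by nlinarith [mul_le_mul_of_nonneg_right key' hsB0])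
    unfold classLaw slope
    rw [← hsAdef, ← hsBdef, ← hZAdef, ← hZBdef, div_le_iff₀ hZA]
    calc sA ≤ Real.exp (2 * |η|) * ZA / ((1 - ε) * ZB) * sB + ε * ZA := h3
      _ = (Real.exp (2 * |η|) / (1 - ε) * (sB / ZB) + ε) * ZA := by
        field_simp

omit [DecidableEq ι] in
/-- A class law takes values in `[0, 1]` (nonnegative weights, positive total). [folklore] -/
theorem classLaw_mem {X : ℕ → ℝ → ι → ℝ} {K : ℕ} {t : ℝ} (hX : ∀ τ ∈ T K, 0 ≤ X K t τ) (hZ : 0 < ∑ τ ∈ T K, X K t τ)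
    {S : Finset ι} (hS : S ⊆ T K) : 0 ≤ classLaw T X K t S ∧ classLaw T X K t S ≤ 1 := by
  unfold classLaw
  refine ⟨div_nonneg (Finset.sum_nonneg fun τ hτ => hX τ (hS hτ)) hZ.le, ?_⟩
  exact (div_le_one hZ).2 (Finset.sum_le_sum_of_subset_of_nonneg hS fun τ hτ _ => hX τ hτ)

/-- The slope is at least one when `W_K + Wsh_K ∈ [0, 1)`. [folklore] -/
theorem one_le_slope {K : ℕ} (hε0 : 0 ≤ W K + Wsh K) (hε : W K + Wsh K < 1) : 1 ≤ slope vol δ W Wsh K := by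
  unfold slope
  refine (one_le_div (by linarith)).2 ?_
  have : (1 : ℝ) ≤ Real.exp (2 * |vol * δ K|) := Real.one_le_exp (by positivity)
  linarith

/-- **THE CLASS LAWS MERGE IN TOTAL VARIATION.**  Under the three faces, at every `(K, t)` with `W_K + Wsh_K < 1` and a positive run-A total:
`|μ_B(S) − μ_A(S)| ≤ ρ_K` for every `S ⊆ T K`. [folklore] -/
theorem abs_classLaw_sub_le_of_faces (hW : RelWeightBound l₀ T A B Bad W) (hSh : ShellWeightBound l₀ T A B shA shB Wsh)
    (hcore : Core l₀ vol T Bad (fun K t τ => A K t τ - shA K t τ) (fun K t τ => B K t τ - shB K t τ) δ)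
    {K : ℕ} (hε : W K + Wsh K < 1) {t : ℝ} (ht : |t| ≤ l₀) (hZA : 0 < ∑ τ ∈ T K, A K t τ) {S : Finset ι} (hS : S ⊆ T K) :
    |classLaw T B K t S - classLaw T A K t S| ≤ rho vol δ W Wsh K := by
  obtain ⟨hZB, hBA, hAB⟩ := classLaw_le_of_faces hW hSh hcore hε ht hZA hS
  have hA0 : ∀ τ ∈ T K, 0 ≤ A K t τ := fun τ hτ =>
    (hSh.sh_nonneg_left K t ht τ hτ).trans (hSh.sh_le_left K t ht τ hτ)
  have hB0 : ∀ τ ∈ T K, 0 ≤ B K t τ := fun τ hτ =>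
    (hSh.sh_nonneg_right K t ht τ hτ).trans (hSh.sh_le_right K t ht τ hτ)
  obtain ⟨hμA0, hμA1⟩ := classLaw_mem hA0 hZA hS
  obtain ⟨hμB0, hμB1⟩ := classLaw_mem hB0 hZB hS
  have hε0 : 0 ≤ W K + Wsh K := add_nonneg (hW.nonneg K) (hSh.nonneg K)
  have hM := one_le_slope (vol := vol) (δ := δ) hε0 hε
  unfold rho
  rw [abs_sub_le_iff]
  constructor
  · nlinarith
  · nlinarith

/-- `ρ_K → 0`: the widths `vol·δ_K` and the weights `W_K`, `Wsh_K` are summable, hence null. [folklore] -/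
theorem tendsto_rho (hδ : Summable δ) (hW : Summable W) (hWsh : Summable Wsh) :
    Tendsto (rho vol δ W Wsh) atTop (𝓝 0) := by
  have hε : Tendsto (fun K => W K + Wsh K) atTop (𝓝 0) := by
    simpa using hW.tendsto_atTop_zero.add hWsh.tendsto_atTop_zero
  have hη : Tendsto (fun K => 2 * |vol * δ K|) atTop (𝓝 0) := by
    simpa using ((hδ.tendsto_atTop_zero.const_mul vol).abs).const_mul 2
  have hexp : Tendsto (fun K => Real.exp (2 * |vol * δ K|)) atTop (𝓝 1) := by
    have h := (Real.continuous_exp.tendsto 0).comp hη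
    rw [Real.exp_zero] at h
    exact h
  have h1ε : Tendsto (fun K => 1 - (W K + Wsh K)) atTop (𝓝 1) := by
    have h := (tendsto_const_nhds (x := (1 : ℝ)) (f := (atTop : Filter ℕ))).sub hε
    rw [sub_zero] at h
    exact h
  have hM : Tendsto (slope vol δ W Wsh) atTop (𝓝 1) := by
    have h := hexp.div h1ε one_ne_zero
    rw [div_one] at h
    unfold slope
    exact h
  have h := (hM.sub (tendsto_const_nhds (x := (1 : ℝ)))).add hε
  rw [sub_self, add_zero] at h
  unfold rho
  exact h

/-! ## §3 No dial rescues a law-separated pair -/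

/-- [letter] **LAW SEPARATION** of the two runs' class weights at size `s`: for every `K₀` there are `K ≥ K₀`, a source `|t| ≤ l₀` and a class set
`S ⊆ T K` on which run B's class law exceeds run A's by at least `s` (one-sided is general: pass to the complement).  At the record this is the
card's (SAT′) ∧ (XG′) in law form — NOT decided here. -/
def LawSeparated (l₀ : ℝ) (T : ℕ → Finset ι) (A B : ℕ → ℝ → ι → ℝ) (s : ℝ) : Prop :=
  ∀ K₀ : ℕ, ∃ K, K₀ ≤ K ∧ ∃ t : ℝ, |t| ≤ l₀ ∧ ∃ S, S ⊆ T K ∧ s ≤ classLaw T B K t S - classLaw T A K t S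

/-- ★ **NO DIAL RESCUES.**  If the class laws of `(T, A, B)` are `s`-separated (`s > 0`) and run A's totals are positive on the window, then for NO
bad-class family `Bad`, NO weights `W`, NO shells `shA, shB`, NO shell weights `Wsh` and NO widths `δ` do the three faces of stub 2 hold together:
`¬ ∃ …, RelWeightBound ∧ ShellWeightBound ∧ (Core on the cores ∧ Summable δ)`.  At the pinned carriers of `PinnedAtLive` this covers the cut dial
`jc` (it moves only `Bad`, `W`) and the shell dial `sh` (it moves only `shA, shB, Wsh`) simultaneously. [folklore] -/
theorem no_dial_rescues {s : ℝ} (hs : 0 < s) (hsep : LawSeparated l₀ T A B s)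
    (hpos : ∀ K t, |t| ≤ l₀ → 0 < ∑ τ ∈ T K, A K t τ) :
    ¬ ∃ (Bad : ℕ → ℝ → Finset ι) (W : ℕ → ℝ) (shA shB : ℕ → ℝ → ι → ℝ) (Wsh δ : ℕ → ℝ),
      RelWeightBound l₀ T A B Bad W ∧ ShellWeightBound l₀ T A B shA shB Wsh ∧
      (Core l₀ vol T Bad (fun K t τ => A K t τ - shA K t τ) (fun K t τ => B K t τ - shB K t τ) δ ∧ Summable δ) := by
  rintro ⟨Bad, W, shA, shB, Wsh, δ, hW, hSh, hcore, hδ⟩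
  have hρ := tendsto_rho (vol := vol) hδ hW.summable hSh.summable
  have hε : Tendsto (fun K => W K + Wsh K) atTop (𝓝 0) := by
    simpa using hW.summable.tendsto_atTop_zero.add hSh.summable.tendsto_atTop_zero
  have hρs : ∀ᶠ K in atTop, rho vol δ W Wsh K < s := hρ.eventually (gt_mem_nhds hs)
  have hε1 : ∀ᶠ K in atTop, W K + Wsh K < 1 := hε.eventually (gt_mem_nhds one_pos)
  obtain ⟨K₀, hK₀⟩ := (hρs.and hε1).exists_forall_of_atTop
  obtain ⟨K, hK, t, ht, S, hS, hsKS⟩ := hsep K₀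
  obtain ⟨hρK, hεK⟩ := hK₀ K hK
  have h := abs_classLaw_sub_le_of_faces hW hSh hcore hεK ht (hpos K t ht) hS
  linarith [le_abs_self (classLaw T B K t S - classLaw T A K t S)]

/-- ★ The same for the hybrid binder list `T4MatchingAssembly.HybridNE7` (whose `weight ∕ shell ∕ core ∕ summable` fields are the three faces;
`lt_one` is not even used). [folklore] -/
theorem not_hybridNE7_of_lawSeparated {s : ℝ} (hs : 0 < s) (hsep : LawSeparated l₀ T A B s)
    (hpos : ∀ K t, |t| ≤ l₀ → 0 < ∑ τ ∈ T K, A K t τ) :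
    ¬ ∃ (Bad : ℕ → ℝ → Finset ι) (W : ℕ → ℝ) (shA shB : ℕ → ℝ → ι → ℝ) (Wsh δ : ℕ → ℝ),
      HybridNE7 l₀ vol T A B Bad W shA shB Wsh δ := by
  rintro ⟨Bad, W, shA, shB, Wsh, δ, h⟩
  exact no_dial_rescues (vol := vol) hs hsep hpos ⟨Bad, W, shA, shB, Wsh, δ, h.weight, h.shell, core_of_hybridNE7 h, h.summable⟩

/-- ★ QUANTITATIVE FORM (the disprover's dial-free handle): under the three faces the separation at step `K` is at most `ρ_K` — so a producer of
the faces with rates `(δ, W, Wsh)` is refuted by ONE `(K, t, S)` with `μ_B(S) − μ_A(S) > ρ_K`. [folklore] -/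
theorem separation_le_rho (hW : RelWeightBound l₀ T A B Bad W) (hSh : ShellWeightBound l₀ T A B shA shB Wsh)
    (hcore : Core l₀ vol T Bad (fun K t τ => A K t τ - shA K t τ) (fun K t τ => B K t τ - shB K t τ) δ)
    {K : ℕ} (hε : W K + Wsh K < 1) {t : ℝ} (ht : |t| ≤ l₀) (hZA : 0 < ∑ τ ∈ T K, A K t τ) {S : Finset ι} (hS : S ⊆ T K) :
    classLaw T B K t S - classLaw T A K t S ≤ rho vol δ W Wsh K :=
  (le_abs_self _).trans (abs_classLaw_sub_le_of_faces hW hSh hcore hε ht hZA hS)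

/-! ## §4 Non-vacuity and target-compatibility: a two-class toy -/

/-- Toy run A: two classes of weight `4^K` each. -/
noncomputable def toyA (K : ℕ) (_t : ℝ) (_b : Bool) : ℝ := 4 ^ K

/-- Toy run B: weights `6·4^K` and `2·4^K`. -/
noncomputable def toyB (K : ℕ) (_t : ℝ) (b : Bool) : ℝ := if b then 6 * 4 ^ K else 2 * 4 ^ K

/-- Toy index family: both classes at every step. -/
def toyT (_K : ℕ) : Finset Bool := Finset.univ

/-- Toy partition functions `Z_K = 2·4^K` (so `Z_K = Σ toyA K`, `Z_{K+1} = Σ toyB K`). -/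
noncomputable def toyZ (K : ℕ) (_t : ℝ) : ℝ := 2 * 4 ^ K

theorem sum_toyA (K : ℕ) (t : ℝ) : ∑ b ∈ toyT K, toyA K t b = 2 * 4 ^ K := by
  simp [toyT, toyA]

theorem sum_toyB (K : ℕ) (t : ℝ) : ∑ b ∈ toyT K, toyB K t b = 8 * 4 ^ K := by
  rw [toyT, Fintype.sum_bool]; simp only [toyB, if_true]; norm_num; ring

/-- The toy's class laws are `1∕4`-separated on `S = {true}` at every step (`μ_A = 1∕2`, `μ_B = 3∕4`). -/
theorem toy_lawSeparated (hl₀ : 0 ≤ l₀) : LawSeparated l₀ toyT toyA toyB (1 / 4) := by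
  intro K₀
  refine ⟨K₀, le_rfl, 0, by simpa using hl₀, {true}, by simp [toyT], ?_⟩
  have h4 : (0 : ℝ) < 4 ^ K₀ := by positivity
  unfold classLaw
  rw [sum_toyA, sum_toyB, Finset.sum_singleton, Finset.sum_singleton]
  simp only [toyA, toyB, if_true]
  have e1 : (6 : ℝ) * 4 ^ K₀ / (8 * 4 ^ K₀) = 3 / 4 := by
    rw [div_eq_div_iff (by positivity) (by norm_num)]; ring
  have e2 : (4 : ℝ) ^ K₀ / (2 * 4 ^ K₀) = 1 / 2 := by
    rw [div_eq_div_iff (by positivity) (by norm_num)]; ring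
  rw [e1, e2]
  norm_num

/-- ★ NON-VACUITY: in the toy NO dial (`Bad`, `W`, shells, `Wsh`, `δ`, for any `vol`) delivers the three faces. -/
theorem toy_no_dial (hl₀ : 0 ≤ l₀) (vol : ℝ) :
    ¬ ∃ (Bad : ℕ → ℝ → Finset Bool) (W : ℕ → ℝ) (shA shB : ℕ → ℝ → Bool → ℝ) (Wsh δ : ℕ → ℝ),
      RelWeightBound l₀ toyT toyA toyB Bad W ∧ ShellWeightBound l₀ toyT toyA toyB shA shB Wsh ∧
      (Core l₀ vol toyT Bad (fun K t τ => toyA K t τ - shA K t τ) (fun K t τ => toyB K t τ - shB K t τ) δ ∧ Summable δ) :=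
  no_dial_rescues (by norm_num) (toy_lawSeparated hl₀) (fun K t _ => by rw [sum_toyA]; positivity)

/-- ★ TARGET-COMPATIBILITY: the toy's partition functions satisfy node U5's DECL target `Spine.NE7.Target vol l₀ 0 toyZ` EXACTLY (constant
`log 4`, width `0`), with the dictionary `toyZ K = Σ toyA K`, `toyZ (K+1) = Σ toyB K` — the target holds while no hybrid certificate exists. -/
theorem toy_target (vol l₀ : ℝ) :
    Target vol l₀ (fun _ => 0) toyZ ∧ (∀ K t, toyZ K t = ∑ b ∈ toyT K, toyA K t b) ∧
      (∀ K t, toyZ (K + 1) t = ∑ b ∈ toyT K, toyB K t b) := by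
  refine ⟨⟨fun K => ⟨Real.log 4, fun t _ => ?_⟩, summable_zero⟩, fun K t => by rw [sum_toyA, toyZ],
    fun K t => by rw [sum_toyB, toyZ]; ring⟩
  have h4 : (0 : ℝ) < 4 ^ K := by positivity
  have : Real.log (toyZ (K + 1) t) - Real.log (toyZ K t) = Real.log 4 := by
    rw [← Real.log_div (by unfold toyZ; positivity) (by unfold toyZ; positivity)]
    congr 1
    unfold toyZ
    rw [pow_succ]
    field_simp
  rw [this]
  simp

end YMNodeOIdeate.Idea3.WindowKeyCore.LawMerge
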